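import Mathlib.Analysis.Normed.Module.FiniteDimension
import Summits.AtomisticToContinuum.Crystallization.Theses.HcpDefectCounting
import Summits.AtomisticToContinuum.Crystallization.Theorems.CoarseGrains.Negative.PredicateAPI
import Summits.AtomisticToContinuum.Crystallization.Theorems.FineGrains.Negative.LoadBearing
import Literature.MathematicalPhysics.StatisticalMechanics.LennardJonesClusters

/-!
# Line `Sketch` (crux `FineGrains`, stmt-AtomisticToContinuum-9330): the LineTwo glue

Stub `stub_lineTwoGlue` of the line skeleton (card `self-certifying-grains`), pure bookkeeping:
`BulkDefectVanish` (shared hinge, item stmt-AtomisticToContinuum-0751, the route decl of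
`Theses.HcpDefectCounting` BY NAME) together with the two neighbouring stubs `SelfCertify` and
`OptimalPeriodicIsAdmissibleHcp` (taken here as UNFOLDED hypotheses, so that the landed theorem needs no
tree-side named `Prop`) give the matrix of the crux `FineGrains`:
`∀ ρ ε > 0, ∃ N₀, ∀ N ≥ N₀, ∀ ground states x, HasFineBall ρ ε x`.

The argument.
* Step A (the hinge's `P` is a periodic minimiser): `SelfCertify` asks that `P` appear, for every
  `(R, ε)` and frequently in `N`, as an origin-based isometric two-way `ε`-chart at a particle of a
  ground state.  Along the sequence of ground states supplied by `LennardJonesGroundStatesExist_holds`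
  the hinge gives `#Bad/N → 0`, hence eventually `#Bad < N` and a Good particle exists
  (`exists_good_of_tendsto`).
* Step B: `OptimalPeriodicIsAdmissibleHcp` then presents `P.points = {t m + A₀ z : m ∈ {0,1}, z ∈ Λ}`
  with `Adm A₀`.
* Step C (`hasFineBall_of_good`): a Good(ρ, ε) particle `i` with isometry `A` is a fine ball — centre
  `x i`, origins `t' m = x i + A (t m)`, cell `A' = A ∘ A₀`; `Adm A'` with the isometry `R₀.trans A`
  since `‖A ∘ A₀ − 0.97 • (A ∘ R₀)‖ ≤ ‖A₀ − 0.97 • R₀‖`, and the two matching clauses translate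
  literally (`‖A q‖ = ‖q‖`).
* Step D (largeness): splice the bad ground states into ONE sequence `s` (at size `N`, a ground state
  without a fine ball if there is one, else any ground state) and apply the hinge to `s` at `(ρ, ε)`:
  for `N ≥ N₁` the configuration `s N` has a Good particle, hence a fine ball, so no ground state of
  `N ≥ N₁` particles lacks one.

All `[folklore]`.  Deliberately NOT here: any statement about which periodic configuration minimises,
or the excision surgery behind `SelfCertify` (these are the neighbouring stubs, entering as hypotheses).
-/

noncomputable section

namespace Summit.AtomisticToContinuum.Crystallization.Theorems.ExcessDecayLiouvilleFineGrains

open Filter Topology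
open Literature.MathematicalPhysics.StatisticalMechanics
open Summit.AtomisticToContinuum.Crystallization.Theorems.CoarseGrains.Negative.PredicateAPI
open Summit.AtomisticToContinuum.Crystallization.Theorems.FineGrains.Negative.LoadBearing
open Summit.AtomisticToContinuum.Crystallization.Theses

/-- **Counting step.** If the fraction of "bad" indices `#{i : Fin N // ¬ Good N i} / N` tends to `0`,
then for all large `N` some index is good: eventually the fraction is `< 1/2`, while "all bad" would
make it `= 1` (for `N ≥ 1`). [folklore] -/
theorem exists_good_of_tendsto {Good : (N : ℕ) → Fin N → Prop}
    (h : Tendsto (fun N : ℕ => (Nat.card {i : Fin N // ¬ Good N i} : ℝ) / N) atTop (𝓝 0)) :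
    ∃ N₁ : ℕ, ∀ N : ℕ, N₁ ≤ N → ∃ i : Fin N, Good N i := by
  have hev : ∀ᶠ N : ℕ in atTop, (Nat.card {i : Fin N // ¬ Good N i} : ℝ) / N < 1 / 2 :=
    h.eventually (gt_mem_nhds (by norm_num))
  obtain ⟨N₁, hN₁⟩ := eventually_atTop.1 hev
  refine ⟨max N₁ 1, fun N hN => ?_⟩
  have hNpos : (0 : ℝ) < N := by exact_mod_cast le_of_max_le_right hN
  have hlt := hN₁ N (le_of_max_le_left hN)
  by_contra hall
  have hall' : ∀ i : Fin N, ¬ Good N i := fun i hi => hall ⟨i, hi⟩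
  have hcard : Nat.card {i : Fin N // ¬ Good N i} = N := by
    rw [Nat.card_congr (Equiv.subtypeUnivEquiv hall'), Nat.card_fin]
  rw [hcard, div_self hNpos.ne'] at hlt
  norm_num at hlt

/-- **A Good particle of an affine hcp two-lattice chart is a fine ball.**  If the point set `S` is
`{t m + A₀ z : m ∈ {0,1}, z ∈ Λ}` with `Adm A₀`, and the particles within `ρ` of `x i` are two-way
`ε`-matched to `x i + A S` for a linear isometry `A`, then `HasFineBall ρ ε x`: centre `x i`, origins
`x i + A (t m)`, cell `A ∘ A₀` (admissible with the isometry `R₀.trans A`). [folklore] -/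
theorem hasFineBall_of_good {ρ ε : ℝ} {t : Fin 2 → E3} {A₀ : E3 →L[ℝ] E3} (hA₀ : Adm A₀)
    {S : Set E3} (hS : S = {p | ∃ m : Fin 2, ∃ z ∈ Lam, p = t m + A₀ z})
    {N : ℕ} (x : Fin N → E3) (i : Fin N) (A : E3 →ₗᵢ[ℝ] E3)
    (h1 : ∀ p ∈ S, ‖p‖ ≤ ρ → ∃ j : Fin N, dist (x j) (x i + A p) ≤ ε)
    (h2 : ∀ j : Fin N, dist (x j) (x i) ≤ ρ → ∃ p ∈ S, dist (x j) (x i + A p) ≤ ε) :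
    HasFineBall ρ ε x := by
  obtain ⟨R₀, hR₀⟩ := hA₀
  have hsite : ∀ (m : Fin 2) (z : E3),
      x i + A (t m) + (A.toContinuousLinearMap.comp A₀) z = x i + A (t m + A₀ z) := by
    intro m z
    simp [add_assoc]
  refine ⟨x i, fun m => x i + A (t m), A.toContinuousLinearMap.comp A₀, ?_, ?_, ?_⟩
  · -- admissibility, with the isometry `z ↦ A (R₀ z)`
    refine ⟨R₀.trans (A.toLinearIsometryEquiv rfl),
      ContinuousLinearMap.opNorm_le_bound _ (by norm_num) fun z => ?_⟩
    have hz : (A.toContinuousLinearMap.comp A₀ - (97 / 100 : ℝ) •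
        ((R₀.trans (A.toLinearIsometryEquiv rfl)).toContinuousLinearEquiv : E3 →L[ℝ] E3)) z =
        A ((A₀ - (97 / 100 : ℝ) • (R₀.toContinuousLinearEquiv : E3 →L[ℝ] E3)) z) := by
      simp [LinearIsometry.map_sub]
    rw [hz, A.norm_map]
    exact (ContinuousLinearMap.le_opNorm _ z).trans
      (mul_le_mul_of_nonneg_right hR₀ (norm_nonneg z))
  · -- particles near the centre are near sites
    rintro p ⟨j, rfl⟩ hj
    obtain ⟨q, hq, hd⟩ := h2 j hj
    rw [hS] at hq
    obtain ⟨m, z, hz, rfl⟩ := hq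
    exact ⟨m, z, hz, by rwa [hsite]⟩
  · -- sites near the centre are near particles
    intro m z hz hR
    rw [hsite] at hR ⊢
    rw [dist_eq_norm, add_sub_cancel_left, A.norm_map] at hR
    have hq : t m + A₀ z ∈ S := by
      rw [hS]
      exact ⟨m, z, hz, rfl⟩
    obtain ⟨j, hj⟩ := h1 _ hq hR
    exact ⟨x j, Set.mem_range_self j, hj⟩

/-- **stub_lineTwoGlue** (line `Sketch`, card `self-certifying-grains`; bookkeeping).
`BulkDefectVanish` (item 0751, BY NAME), `SelfCertify` and `OptimalPeriodicIsAdmissibleHcp` (unfolded)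
give the matrix of the crux `FineGrains`: the hinge's `P` is certified a periodic minimiser by
`SelfCertify` (Good particles exist eventually along the ground states of
`LennardJonesGroundStatesExist_holds`, since `#Bad/N → 0`), hence `P.points = {t m + A₀ z}` with
`Adm A₀`; a Good(ρ, ε) particle is a fine ball (`hasFineBall_of_good`); and for `N` large EVERY
ground state has a Good particle (splice the bad ground states into one sequence and apply the hinge:
`#Bad/N → 0` forbids `#Bad = N` for large `N`). [folklore] -/
theorem stub_lineTwoGlue :
    HcpDefectCounting.BulkDefectVanish →
    (∀ P : PeriodicConfiguration 3,
      (∀ R ε : ℝ, 0 < R → 0 < ε → ∀ N₀ : ℕ, ∃ N : ℕ, N₀ ≤ N ∧ ∃ x : Fin N → E3,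
        IsGroundState lennardJones x ∧ ∃ (i : Fin N) (A : E3 →ₗᵢ[ℝ] E3),
          (∀ p ∈ P.points, ‖p‖ ≤ R → ∃ j : Fin N, dist (x j) (x i + A p) ≤ ε) ∧
          (∀ j : Fin N, dist (x j) (x i) ≤ R → ∃ p ∈ P.points, dist (x j) (x i + A p) ≤ ε)) →
      IsLeast (Set.range fun Q : PeriodicConfiguration 3 => Q.energyPerParticle lennardJones)
        (P.energyPerParticle lennardJones)) →
    (∀ Q : PeriodicConfiguration 3,
      IsLeast (Set.range fun Q' : PeriodicConfiguration 3 => Q'.energyPerParticle lennardJones)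
        (Q.energyPerParticle lennardJones) →
      ∃ (t : Fin 2 → E3) (A : E3 →L[ℝ] E3), Adm A ∧
        Q.points = {p | ∃ m : Fin 2, ∃ z ∈ Lam, p = t m + A z}) →
    ∀ ρ ε : ℝ, 0 < ρ → 0 < ε → ∃ N₀ : ℕ, ∀ N : ℕ, N₀ ≤ N → ∀ x : Fin N → E3,
      IsGroundState lennardJones x → HasFineBall ρ ε x := by
  classical
  rintro ⟨P, hP⟩ hSelf hOpt ρ ε hρ hε
  -- Step A: the hinge's `P` is a periodic minimiser (self-certification along any ground states)
  have hmin : IsLeast (Set.range fun Q : PeriodicConfiguration 3 => Q.energyPerParticle lennardJones)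
      (P.energyPerParticle lennardJones) := by
    refine hSelf P fun R' ε' hR' hε' N₀ => ?_
    have hg : ∀ N : ℕ, IsGroundState lennardJones
        (Classical.choose (LennardJonesGroundStatesExist_holds N)) := fun N =>
      Classical.choose_spec (LennardJonesGroundStatesExist_holds N)
    obtain ⟨N₁, hN₁⟩ := exists_good_of_tendsto (hP R' ε' hR' hε' _ hg)
    obtain ⟨i, A, hA⟩ := hN₁ (max N₀ N₁) (le_max_right _ _)
    exact ⟨max N₀ N₁, le_max_left _ _, _, hg _, i, A, hA⟩
  -- Step B: `P` is an admissible affine hcp two-lattice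
  obtain ⟨t, A₀, hA₀, hpts⟩ := hOpt P hmin
  -- Step D: splice the bad ground states into one sequence and apply the hinge at `(ρ, ε)`
  set s : (N : ℕ) → (Fin N → E3) := fun N =>
    if h : ∃ y : Fin N → E3, IsGroundState lennardJones y ∧ ¬ HasFineBall ρ ε y then h.choose
    else Classical.choose (LennardJonesGroundStatesExist_holds N) with hs_def
  have hs : ∀ N : ℕ, IsGroundState lennardJones (s N) := by
    intro N
    simp only [hs_def]
    split_ifs with h
    · exact h.choose_spec.1
    · exact Classical.choose_spec (LennardJonesGroundStatesExist_holds N)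
  obtain ⟨N₁, hN₁⟩ := exists_good_of_tendsto (hP ρ ε hρ hε s hs)
  refine ⟨N₁, fun N hN x hx => ?_⟩
  by_contra hxbad
  have h : ∃ y : Fin N → E3, IsGroundState lennardJones y ∧ ¬ HasFineBall ρ ε y := ⟨x, hx, hxbad⟩
  have hsN : s N = h.choose := by
    simp only [hs_def]
    rw [dif_pos h]
  have hbad : ¬ HasFineBall ρ ε (s N) := by
    rw [hsN]
    exact h.choose_spec.2
  -- Step C: a Good particle of `s N` is a fine ball
  obtain ⟨i, A, hA1, hA2⟩ := hN₁ N hN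
  exact hbad (hasFineBall_of_good hA₀ hpts (s N) i A hA1 hA2)

end Summit.AtomisticToContinuum.Crystallization.Theorems.ExcessDecayLiouvilleFineGrains

end
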